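import Summits.Ventures.YMGap.RobustBall.EnergyVarianceBessel
import HarnessLib

/-!
# Robust ball (Y2), strong-coupling laws — the inverse Efron–Stein inequality, II: one-site Gibbs kernels and the fibre-variance floor

HONEST FRAMING: venture file of the cell `pub-ymgap` (QuantumFields programme), track ROBUST-BALL, seat rb-p2 (g8).  GENERIC
finite-dimensional probability, sequel of `EnergyVarianceBessel.lean` (Part A: for a law `Q` resampling-invariant under local Markov
kernels `qᵢ`, `Var_Q(f) ≥ ∑_{i ∈ F} ∫ f (f − Πᵢ f) dQ` over any set `F` of pairwise "separated" sites).  Here the kernels are the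
one-site GIBBS kernels `qᵢ(ξ)(dy) ∝ exp(−A(ξ^{i←y})) πᵢ(dy)` of a bounded measurable energy `A` on a finite product with a-priori
probability laws `πᵢ` (tree `T4DobrushinTensorisation.gibbsKernel / gibbsMeasure`), and we prove:
* `exp_neg_le_gibbsDensity` — one-site oscillation of `A` at `i` `≤ δ` ⇒ the one-site density is `≥ e^{−δ}`;
* `gibbsKernel_update_of_separable` — if `A` is additively separable in the coordinates `i ≠ j`, the kernel at `i` does not read
  the coordinate `j` (finite range of the one-site law);
* `dirichlet_ge_exp_neg_mul_fibreVariance` — `∫ f (f − Πᵢ f) dQ ≥ e^{−δ} ∫ Var_{πᵢ}(y ↦ f(ξ^{i←y})) dQ(ξ)` (the one-site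
  Dirichlet form dominates the mean A-PRIORI fibre variance, up to the density floor);
* `exp_neg_mul_integral_resample_le` — resampling one site from its a-priori law costs at most `e^{−δ}` on the mean of a
  non-negative observable (DLR identity + density floor);
* ★★ `sum_fibreVariance_le_variance_gibbs` — for `Q = gibbsMeasure π A`:
  `e^{−δ} ∑_{i ∈ F} ∫ Var_{πᵢ}(y ↦ f(ξ^{i←y})) dQ(ξ) ≤ Var_Q(f)` whenever `A` and `f` are separable across the pairs of `F` and the
  one-site oscillation of `A` on `F` is `≤ δ`.
This is the engine of the torus energy-variance floor (`EnergyVarianceTorus.lean`).  Nothing here is about the continuum, a spectral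
gap or the Clay problem.

References (statement type only; everything is proved): H.-O. Georgii, *Gibbs Measures and Phase Transitions* (2011), Remark 1.24;
B. Efron, C. Stein, Ann. Statist. 9 (1981) 586. [folklore]
-/

noncomputable section

open MeasureTheory ProbabilityTheory Finset Function
open Literature.MathematicalPhysics.QuantumFieldTheory.Balaban1983to89.T4DobrushinTensorisation
open Literature.MathematicalPhysics.QuantumFieldTheory.Balaban1983to89.T4CouplingChain (integrable_of_abs_le_const)

namespace Summit.Ventures.YMGap.RobustBall

namespace EnergyVariance

universe u v

variable {ι : Type u} [Fintype ι] [DecidableEq ι] {E : ι → Type v} [∀ i, MeasurableSpace (E i)]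

/-! ### Part B — one-site Gibbs kernels: density floor, locality under separability, the fibre variance -/

section Gibbs

variable {π : (i : ι) → Measure (E i)} [∀ i, IsProbabilityMeasure (π i)] {A : ((j : ι) → E j) → ℝ}

omit [Fintype ι] in
/-- **Density floor.**  If the one-site oscillation of the energy at `i` on the fibre of `ξ` is `≤ δ`
(`A(ξ^{i←y}) − A(ξ^{i←z}) ≤ δ` for all `y, z`), the one-site Gibbs density is `≥ e^{−δ}`. [folklore] -/
theorem exp_neg_le_gibbsDensity (hAm : Measurable A) {a : ℝ} (hAb : ∀ ξ, |A ξ| ≤ a) (i : ι)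
    (ξ : (j : ι) → E j) {δ : ℝ} (hosc : ∀ y z : E i, A (update ξ i y) - A (update ξ i z) ≤ δ) (y : E i) :
    Real.exp (-δ) ≤ gibbsDensity π A i ξ y := by
  have hZ0 := siteZ_pos (π := π) hAm hAb i ξ
  have hint : Integrable (fun z => Real.exp (-A (update ξ i z))) (π i) :=
    integrable_of_abs_le_const (μ := π i)
      (Real.measurable_exp.comp (hAm.comp (measurable_update ξ)).neg).stronglyMeasurable
      (R := Real.exp a) fun z => by
        rw [abs_of_pos (Real.exp_pos _)]; exact (exp_neg_energy_bounds hAb _).2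
  have hZle : siteZ π A i ξ ≤ Real.exp (-A (update ξ i y) + δ) := by
    have h := integral_mono hint (integrable_const (Real.exp (-A (update ξ i y) + δ)))
      fun z => Real.exp_le_exp.2 (by have := hosc y z; linarith)
    simpa [siteZ, probReal_univ] using h
  rw [gibbsDensity, le_div_iff₀ hZ0]
  calc Real.exp (-δ) * siteZ π A i ξ ≤ Real.exp (-δ) * Real.exp (-A (update ξ i y) + δ) :=
        mul_le_mul_of_nonneg_left hZle (Real.exp_pos _).le
    _ = Real.exp (-A (update ξ i y)) := by rw [← Real.exp_add]; ring_nf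

omit [Fintype ι] in
/-- **Locality under separability.**  If the energy is additively separable in the coordinates `i ≠ j` on the fibre
(`A(ξ^{j←y, i←z}) − A(ξ^{i←z})` does not depend on `z`), the one-site Gibbs kernel at `i` does not read the coordinate `j`:
`qᵢ(ξ^{j←y}) = qᵢ(ξ)` (finite range / Markov property of the one-site law). [folklore] -/
theorem gibbsKernel_update_of_separable (hAm : Measurable A) (i j : ι) (ξ : (k : ι) → E k) (y : E j)
    (hsep : ∀ z : E i, A (update (update ξ j y) i z) - A (update ξ i z) = A (update ξ j y) - A ξ) :
    gibbsKernel π A i (update ξ j y) = gibbsKernel π A i ξ := by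
  rw [gibbsKernel_apply hAm, gibbsKernel_apply hAm]
  congr 1
  funext z
  congr 1
  set c : ℝ := A (update ξ j y) - A ξ with hc
  have h1 : ∀ w : E i, Real.exp (-A (update (update ξ j y) i w)) = Real.exp (-c) * Real.exp (-A (update ξ i w)) := by
    intro w
    rw [← Real.exp_add]
    congr 1
    have := hsep w
    linarith
  have hZ : siteZ π A i (update ξ j y) = Real.exp (-c) * siteZ π A i ξ := by
    rw [siteZ, siteZ, ← integral_const_mul]
    exact integral_congr_ae (Filter.Eventually.of_forall fun w => h1 w)
  rw [gibbsDensity, gibbsDensity, hZ, h1 z, mul_div_mul_left _ _ (Real.exp_pos _).ne']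

omit [Fintype ι] [∀ i, IsProbabilityMeasure (π i)] in
/-- The a-priori **fibre variance** of `f` at the site `i` on the fibre of `ξ`:
`Var_{πᵢ}(y ↦ f(ξ^{i←y})) = ∫ (f(ξ^{i←y}) − ∫ f(ξ^{i←z}) dπᵢ(z))² dπᵢ(y)` — written out, no definition. It does not read the
`i`-th coordinate of `ξ`. [folklore] -/
theorem fibreVariance_update (i : ι) (f : ((j : ι) → E j) → ℝ) (ξ : (j : ι) → E j) (w : E i) :
    (∫ y, (f (update (update ξ i w) i y) - ∫ z, f (update (update ξ i w) i z) ∂π i) ^ 2 ∂π i) =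
      ∫ y, (f (update ξ i y) - ∫ z, f (update ξ i z) ∂π i) ^ 2 ∂π i := by
  simp only [update_idem]

omit [Fintype ι] in
/-- On a probability space the mean minimises the mean-square deviation: `∫ (h − ∫ h)² dν ≤ ∫ (h − m)² dν`. [folklore] -/
theorem integral_sub_mean_sq_le {S : Type*} [MeasurableSpace S] {ν : Measure S} [IsProbabilityMeasure ν]
    {h : S → ℝ} (hm : Measurable h) {B : ℝ} (hB : ∀ s, |h s| ≤ B) (m : ℝ) :
    ∫ s, (h s - ∫ s', h s' ∂ν) ^ 2 ∂ν ≤ ∫ s, (h s - m) ^ 2 ∂ν := by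
  set a : ℝ := ∫ s', h s' ∂ν with ha
  have hab : |a| ≤ B := abs_integral_le_of_abs_le ν hB
  have hi : Integrable h ν := integrable_of_abs_le_const hm.stronglyMeasurable hB
  have hi1 : Integrable (fun s => (h s - a) ^ 2) ν :=
    integrable_of_abs_le_const ((hm.sub measurable_const).pow_const 2).stronglyMeasurable (R := (B + B) ^ 2) fun s => by
      rw [abs_pow]; exact pow_le_pow_left₀ (abs_nonneg _) ((abs_sub _ _).trans (add_le_add (hB s) hab)) 2
  have hi2 : Integrable (fun s => 2 * (a - m) * (h s - a)) ν := (hi.sub (integrable_const a)).const_mul _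
  have hi12 : Integrable (fun s => (h s - a) ^ 2 + 2 * (a - m) * (h s - a)) ν := hi1.add hi2
  have hsplit : ∀ s, (h s - m) ^ 2 = ((h s - a) ^ 2 + 2 * (a - m) * (h s - a)) + (a - m) ^ 2 := fun s => by ring
  simp_rw [hsplit]
  rw [integral_add hi12 (integrable_const _), integral_add hi1 hi2, integral_const_mul,
    integral_sub hi (integrable_const a), integral_const, integral_const]
  simp only [smul_eq_mul, probReal_univ, one_mul]
  rw [← ha, sub_self, mul_zero, add_zero]
  nlinarith [sq_nonneg (a - m)]

omit [Fintype ι] in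
/-- **The one-site Dirichlet form of the Gibbs law dominates `e^{−δ}` times the mean a-priori fibre variance.**  For the Gibbs law
`Q` (resampling-invariant for the one-site Gibbs kernels of `A`) and a site `i` where the one-site oscillation of `A` is `≤ δ`:
`∫ f (f − Πᵢ f) dQ ≥ e^{−δ} ∫ Var_{πᵢ}(y ↦ f(ξ^{i←y})) dQ(ξ)`. [folklore] -/
theorem dirichlet_ge_exp_neg_mul_fibreVariance (hAm : Measurable A) {a : ℝ} (hAb : ∀ ξ, |A ξ| ≤ a)
    {Q : Measure ((j : ι) → E j)} [IsProbabilityMeasure Q]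
    (hinv : ResamplingInvariant Q (gibbsKernel π A)) (i : ι) {δ : ℝ}
    (hosc : ∀ (ξ : (j : ι) → E j) (y z : E i), A (update ξ i y) - A (update ξ i z) ≤ δ)
    {f : ((j : ι) → E j) → ℝ} {B : ℝ} (hfm : Measurable f) (hB : ∀ ξ, |f ξ| ≤ B) :
    Real.exp (-δ) * ∫ ξ, (∫ y, (f (update ξ i y) - ∫ z, f (update ξ i z) ∂π i) ^ 2 ∂π i) ∂Q ≤
      ∫ ξ, f ξ * (f ξ - resample (gibbsKernel π A) i f ξ) ∂Q := by
  haveI : ∀ i, IsMarkovKernel (gibbsKernel π A i) := fun i => isMarkovKernel_gibbsKernel hAm hAb i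
  have hloc : ∀ (i : ι) (ξ : (j : ι) → E j) (y : E i), gibbsKernel π A i (update ξ i y) = gibbsKernel π A i ξ :=
    fun i ξ y => gibbsKernel_update hAm i ξ y
  set q := gibbsKernel π A with hqdef
  -- `∫ f (f − Πᵢ f) dQ = ∫ (f − Πᵢ f)² dQ = ∫ Πᵢ[(f − Πᵢ f)²] dQ`
  rw [← integral_fluct_sq_eq hloc hinv i hfm hB]
  have hXm : Measurable fun ξ => (f ξ - resample q i f ξ) ^ 2 := (hfm.sub (measurable_resample i hfm)).pow_const 2
  have hXb : ∀ ξ, |(f ξ - resample q i f ξ) ^ 2| ≤ (B + B) ^ 2 := fun ξ => by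
    rw [abs_pow]
    exact pow_le_pow_left₀ (abs_nonneg _) ((abs_sub _ _).trans (add_le_add (hB ξ) (abs_resample_le i hB ξ))) 2
  rw [← hinv i (fun ξ => (f ξ - resample q i f ξ) ^ 2) ((B + B) ^ 2) hXm hXb]
  simp only [resample_update hloc]
  -- pointwise on each fibre: density floor, then the mean minimises the square deviation
  rw [← integral_const_mul]
  refine integral_mono_of_nonneg (Filter.Eventually.of_forall fun ξ => ?_) ?_ (Filter.Eventually.of_forall fun ξ => ?_)
  · exact mul_nonneg (Real.exp_pos _).le (integral_nonneg fun y => sq_nonneg _)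
  · have hm : Measurable fun ξ : (j : ι) → E j => ∫ y, (f (update ξ i y) - resample q i f ξ) ^ 2 ∂(q i ξ) := by
      have h : StronglyMeasurable (fun p : ((j : ι) → E j) × E i => (f (update p.1 i p.2) - resample q i f p.1) ^ 2) :=
        (((hfm.comp measurable_update').sub ((measurable_resample i hfm).comp measurable_fst)).pow_const 2).stronglyMeasurable
      exact (h.integral_kernel_prod_right' (κ := q i)).measurable
    refine integrable_of_abs_le_const hm.stronglyMeasurable (R := (B + B) ^ 2) fun ξ => ?_
    exact abs_integral_le_of_abs_le (q i ξ) fun y => by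
      rw [abs_pow]
      exact pow_le_pow_left₀ (abs_nonneg _) ((abs_sub _ _).trans (add_le_add (hB _) (abs_resample_le i hB ξ))) 2
  · -- the fibre inequality
    have hgm : Measurable fun y : E i => (f (update ξ i y) - resample q i f ξ) ^ 2 :=
      ((hfm.comp (measurable_update ξ)).sub measurable_const).pow_const 2
    have hgb : ∀ y : E i, |(f (update ξ i y) - resample q i f ξ) ^ 2| ≤ (B + B) ^ 2 := fun y => by
      rw [abs_pow]
      exact pow_le_pow_left₀ (abs_nonneg _) ((abs_sub _ _).trans (add_le_add (hB _) (abs_resample_le i hB ξ))) 2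
    have hgi : Integrable (fun y : E i => (f (update ξ i y) - resample q i f ξ) ^ 2) (π i) :=
      integrable_of_abs_le_const hgm.stronglyMeasurable hgb
    calc Real.exp (-δ) * ∫ y, (f (update ξ i y) - ∫ z, f (update ξ i z) ∂π i) ^ 2 ∂π i
        ≤ Real.exp (-δ) * ∫ y, (f (update ξ i y) - resample q i f ξ) ^ 2 ∂π i :=
          mul_le_mul_of_nonneg_left (integral_sub_mean_sq_le (hfm.comp (measurable_update ξ)) (fun y => hB _) _)
            (Real.exp_pos _).le
      _ = ∫ y, Real.exp (-δ) * (f (update ξ i y) - resample q i f ξ) ^ 2 ∂π i := (integral_const_mul _ _).symm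
      _ ≤ ∫ y, gibbsDensity π A i ξ y * (f (update ξ i y) - resample q i f ξ) ^ 2 ∂π i := by
          refine integral_mono (hgi.const_mul _) ?_ fun y => ?_
          · exact integrable_of_abs_le_const ((measurable_gibbsDensity_right hAm i ξ).mul hgm).stronglyMeasurable
              (R := Real.exp (2 * a) * (B + B) ^ 2) fun y => by
                rw [abs_mul, abs_of_nonneg (gibbsDensity_bounds hAm hAb i ξ y).1]
                exact mul_le_mul (gibbsDensity_bounds hAm hAb i ξ y).2 (hgb y) (abs_nonneg _) (Real.exp_pos _).le
          · exact mul_le_mul_of_nonneg_right (exp_neg_le_gibbsDensity hAm hAb i ξ (hosc ξ) y) (sq_nonneg _)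
      _ = ∫ y, (f (update ξ i y) - resample q i f ξ) ^ 2 ∂(q i ξ) := (integral_gibbsKernel hAm hAb i ξ _).symm

omit [Fintype ι] in
/-- **Resampling a site from its a-priori law costs at most `e^{−δ}` on the mean of a non-negative observable**:
`e^{−δ} ∫ (∫ g(ξ^{i←y}) dπᵢ(y)) dQ(ξ) ≤ ∫ g dQ` for the Gibbs law `Q`, when the one-site oscillation of `A` at `i` is `≤ δ`
(DLR identity at `i` + density floor). [folklore] -/
theorem exp_neg_mul_integral_resample_le (hAm : Measurable A) {a : ℝ} (hAb : ∀ ξ, |A ξ| ≤ a)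
    {Q : Measure ((j : ι) → E j)} [IsProbabilityMeasure Q]
    (hinv : ResamplingInvariant Q (gibbsKernel π A)) (i : ι) {δ : ℝ}
    (hosc : ∀ (ξ : (j : ι) → E j) (y z : E i), A (update ξ i y) - A (update ξ i z) ≤ δ)
    {g : ((j : ι) → E j) → ℝ} {B : ℝ} (hgm : Measurable g) (hB : ∀ ξ, |g ξ| ≤ B) (hg0 : ∀ ξ, 0 ≤ g ξ) :
    Real.exp (-δ) * ∫ ξ, (∫ y, g (update ξ i y) ∂π i) ∂Q ≤ ∫ ξ, g ξ ∂Q := by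
  haveI : ∀ i, IsMarkovKernel (gibbsKernel π A i) := fun i => isMarkovKernel_gibbsKernel hAm hAb i
  rw [← hinv i g B hgm hB, ← integral_const_mul]
  refine integral_mono_of_nonneg (Filter.Eventually.of_forall fun ξ => ?_) ?_ (Filter.Eventually.of_forall fun ξ => ?_)
  · exact mul_nonneg (Real.exp_pos _).le (integral_nonneg fun y => hg0 _)
  · have hm : Measurable fun ξ : (j : ι) → E j => ∫ y, g (update ξ i y) ∂(gibbsKernel π A i ξ) :=
      measurable_resample i hgm
    exact integrable_of_abs_le_const hm.stronglyMeasurable (abs_resample_le (q := gibbsKernel π A) i hB)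
  · have hgi : Integrable (fun y : E i => g (update ξ i y)) (π i) :=
      integrable_of_abs_le_const (hgm.comp (measurable_update ξ)).stronglyMeasurable fun y => hB _
    calc Real.exp (-δ) * ∫ y, g (update ξ i y) ∂π i = ∫ y, Real.exp (-δ) * g (update ξ i y) ∂π i :=
          (integral_const_mul _ _).symm
      _ ≤ ∫ y, gibbsDensity π A i ξ y * g (update ξ i y) ∂π i := by
          refine integral_mono (hgi.const_mul _) ?_ fun y =>
            mul_le_mul_of_nonneg_right (exp_neg_le_gibbsDensity hAm hAb i ξ (hosc ξ) y) (hg0 _)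
          exact integrable_of_abs_le_const
            ((measurable_gibbsDensity_right hAm i ξ).mul (hgm.comp (measurable_update ξ))).stronglyMeasurable
            (R := Real.exp (2 * a) * B) fun y => by
              rw [abs_mul, abs_of_nonneg (gibbsDensity_bounds hAm hAb i ξ y).1]
              exact mul_le_mul (gibbsDensity_bounds hAm hAb i ξ y).2 (hB _) (abs_nonneg _) (Real.exp_pos _).le
      _ = ∫ y, g (update ξ i y) ∂(gibbsKernel π A i ξ) := (integral_gibbsKernel hAm hAb i ξ _).symm

/-- ★★ **The variance floor for a Gibbs law on a finite product (packaged).**  `Q = gibbsMeasure π A` the Gibbs law of a bounded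
measurable energy `A`, `f` bounded measurable, `F` a finite set of sites such that for `i ≠ i'` in `F` both `A` and `f` are
additively separable in the coordinates `i, i'`, and the one-site oscillation of `A` at every `i ∈ F` is `≤ δ`.  Then

  `e^{−δ} ∑_{i ∈ F} ∫ Var_{πᵢ}(y ↦ f(ξ^{i←y})) dQ(ξ) ≤ ∫ (f − ∫ f dQ)² dQ`. [folklore] -/
theorem sum_fibreVariance_le_variance_gibbs (hAm : Measurable A) {a : ℝ} (hAb : ∀ ξ, |A ξ| ≤ a)
    {f : ((j : ι) → E j) → ℝ} {B : ℝ} (hfm : Measurable f) (hB : ∀ ξ, |f ξ| ≤ B) (F : Finset ι) {δ : ℝ}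
    (hosc : ∀ i ∈ F, ∀ (ξ : (j : ι) → E j) (y z : E i), A (update ξ i y) - A (update ξ i z) ≤ δ)
    (hsepA : ∀ i ∈ F, ∀ i' ∈ F, i ≠ i' → ∀ (ξ : (j : ι) → E j) (y : E i') (z : E i),
      A (update (update ξ i' y) i z) - A (update ξ i z) = A (update ξ i' y) - A ξ)
    (hsepf : ∀ i ∈ F, ∀ i' ∈ F, i ≠ i' → ∀ (ξ : (j : ι) → E j) (y : E i') (z : E i),
      f (update (update ξ i' y) i z) - f (update ξ i z) = f (update ξ i' y) - f ξ) :
    Real.exp (-δ) * ∑ i ∈ F, ∫ ξ, (∫ y, (f (update ξ i y) - ∫ z, f (update ξ i z) ∂π i) ^ 2 ∂π i) ∂gibbsMeasure π A ≤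
      ∫ ξ, (f ξ - ∫ ζ, f ζ ∂gibbsMeasure π A) ^ 2 ∂gibbsMeasure π A := by
  haveI : ∀ i, IsMarkovKernel (gibbsKernel π A i) := fun i => isMarkovKernel_gibbsKernel hAm hAb i
  haveI := isProbabilityMeasure_gibbsMeasure (π := π) hAm hAb
  have hloc : ∀ (i : ι) (ξ : (j : ι) → E j) (y : E i), gibbsKernel π A i (update ξ i y) = gibbsKernel π A i ξ :=
    fun i ξ y => gibbsKernel_update hAm i ξ y
  have hinv := resamplingInvariant_gibbs (π := π) hAm hAb
  have hq : ∀ i ∈ F, ∀ i' ∈ F, i ≠ i' → ∀ (ξ : (j : ι) → E j) (y : E i'),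
      gibbsKernel π A i (update ξ i' y) = gibbsKernel π A i ξ :=
    fun i hi i' hi' h ξ y => gibbsKernel_update_of_separable hAm i i' ξ y (hsepA i hi i' hi' h ξ y)
  refine le_trans ?_ (sum_dirichlet_le_variance hloc hinv hfm hB F hsepf hq)
  rw [Finset.mul_sum]
  exact Finset.sum_le_sum fun i hi => dirichlet_ge_exp_neg_mul_fibreVariance hAm hAb hinv i (hosc i hi) hfm hB

end Gibbs

end EnergyVariance

end Summit.Ventures.YMGap.RobustBall
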